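import Summits.QuantumFields.YangMills.Theorems.IR.Negative.HairpinStokes.TopFace

/-!
# Crux `IR` (stmt-QuantumFields-19354) — HAIRPIN STOKES for the layer comb, part 3/3 (headline): R1d′ = `twistAction_le_weighted`
# PROVED — the boundary Wilson action of the twisted configuration is dominated by a fixed weighted plaquette sum, Σ w ≤ C b⁵ (section `Assembly`)

Re-homed VERBATIM (names, statements, proofs; namespace `CruxIdea2g7Hairpin` ↦ `HairpinStokes`) from `Cruxes/IR/CruxIdea2HairpinStokes.lean`
rev 3 (sha16 9564a081d3085d3d, author `ym-cruxidea-19354-2` GEN 7) per owner R114 (2); credit ∕ docstring of record in part 1/3 `HairpinStokes/Algebra.lean`.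
Negative knowledge for stmt-QuantumFields-19354 (`--supports`; closes no stub); not mixing, not a mass gap, nothing about Clay.
-/

set_option autoImplicit false
noncomputable section
open Literature.MathematicalPhysics.QuantumLattice
open Literature.Probability.LatticeModels
open Summit.QuantumFields.YangMills.Cruxes.IR.FixedMeshAllG
open Summit.QuantumFields.YangMills.Theorems.FemtoCurvatureTwoPoint.DoublingOfRV (norm_rho_mul_sub_one_le norm_rho_inv_sub_one)
namespace Summit.QuantumFields.YangMills.Cruxes.IR.HairpinStokes

section Assembly
/-! ### R1d′ — THE ASSEMBLY: the boundary Wilson action of the twisted configuration is dominated by a fixed weighted sum of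
plaquette energies of `σ`, total weight `≤ C(n) b⁵` -/

open scoped Matrix Matrix.Norms.Frobenius
open Summit.QuantumFields.YangMills.Cruxes.IR.FixedMesh

variable {G : Type} [Group G] {N : ℕ} (ρ : G →* Matrix (Fin N) (Fin N) ℂ)

/-- The plaquette energy `N − Re tr ρ(σ_q)` of the plaquette `q`. -/
def pe (q : ZdPlaquette 4) (σ : LGConfig 4 G) : ℝ := (N : ℝ) - plaquetteObs ρ q.1 q.2.1.1 q.2.1.2 σ

/-- Helper lemma `pe_nonneg` of the hairpin-Stokes chain (re-homed verbatim from the crux workfile; see the module docstring). -/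
theorem pe_nonneg (hρu : ∀ g, ρ g ∈ Matrix.unitaryGroup (Fin N) ℂ) (q : ZdPlaquette 4) (σ : LGConfig 4 G) :
    0 ≤ pe ρ q σ := by
  unfold pe plaquetteObs
  rw [sub_re_trace_eq_norm_sq ρ hρu]
  positivity

/-- Helper lemma `norm_sq_eq_two_mul_energy` of the hairpin-Stokes chain (re-homed verbatim from the crux workfile; see the module docstring). -/
theorem norm_sq_eq_two_mul_energy (hρu : ∀ g, ρ g ∈ Matrix.unitaryGroup (Fin N) ℂ) (x : Site 4) (i j : Fin 4)
    (σ : LGConfig 4 G) :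
    ‖ρ (plaquetteHolonomyZd σ x i j) - 1‖ ^ 2 = 2 * ((N : ℝ) - plaquetteObs ρ x i j σ) := by
  unfold plaquetteObs
  rw [sub_re_trace_eq_norm_sq ρ hρu]
  ring

/-- Helper lemma `wilsonBoundaryAction_eq_sum_pe` of the hairpin-Stokes chain (re-homed verbatim from the crux workfile; see the module docstring). -/
theorem wilsonBoundaryAction_eq_sum_pe (Λ : Finset (ZdEdge 4)) (σ : LGConfig 4 G) :
    wilsonBoundaryAction ρ Λ σ = ∑ q ∈ plaquettesTouching Λ, pe ρ q σ := rfl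

/-- The `k`-th plaquette of the direction-3 strip of the hairpin across the layer link `(y, j)` (`j < 3`; junk otherwise). -/
def hp3 (b R : ℕ) (y : Site 4) (j : Fin 4) (k : ℕ) : ZdPlaquette 4 :=
  if h : j < 3 then (combPt3 b R y + Pi.single 3 (k : ℤ), ⟨(j, 3), h⟩) else (y, ⟨(0, 1), by decide⟩)

/-- The `k`-th plaquette of the direction-2 strip of the hairpin across a layer link in direction 1 at `y`. -/
def hp2 (b R : ℕ) (y : Site 4) (k : ℕ) : ZdPlaquette 4 :=
  (combPt2 b R y + Pi.single 2 (k : ℤ), ⟨(1, 2), by decide⟩)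

/-- The COEFFICIENT of the plaquette `p` (energies of `σ`) in the bound for the energy of the plaquette `q` of the twisted
configuration: `2·[q = p]`, plus, for a top-face `q`, `32 R` times the multiplicity of `p` among the hairpin plaquettes of `q`. -/
def coef (b R : ℕ) (q p : ZdPlaquette 4) : ℝ :=
  2 * (if q = p then 1 else 0) +
    if q.2.1.1 = 0 ∧ q.1 0 = (b : ℤ) then
      32 * (R : ℝ) *
        ((∑ k ∈ Finset.range (combLen R (q.1 + Pi.single 0 1) 3),
            if hp3 b R (q.1 + Pi.single 0 1) q.2.1.2 k = p then (1 : ℝ) else 0) +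
          ∑ k ∈ Finset.range (combLen R (q.1 + Pi.single 0 1) 2),
            if hp2 b R (q.1 + Pi.single 0 1) k = p then (1 : ℝ) else 0)
    else 0

/-- Helper lemma `coef_nonneg` of the hairpin-Stokes chain (re-homed verbatim from the crux workfile; see the module docstring). -/
theorem coef_nonneg (b R : ℕ) (q p : ZdPlaquette 4) : 0 ≤ coef b R q p := by
  unfold coef
  have h1 : (0 : ℝ) ≤ 2 * (if q = p then 1 else 0) := by split_ifs <;> norm_num
  have h2 : (0 : ℝ) ≤ ∑ k ∈ Finset.range (combLen R (q.1 + Pi.single 0 1) 3),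
      (if hp3 b R (q.1 + Pi.single 0 1) q.2.1.2 k = p then (1 : ℝ) else 0) :=
    Finset.sum_nonneg fun k _ => by split_ifs <;> norm_num
  have h3 : (0 : ℝ) ≤ ∑ k ∈ Finset.range (combLen R (q.1 + Pi.single 0 1) 2),
      (if hp2 b R (q.1 + Pi.single 0 1) k = p then (1 : ℝ) else 0) :=
    Finset.sum_nonneg fun k _ => by split_ifs <;> norm_num
  split_ifs <;> positivity

/-- Helper lemma `sum_ite_eq_mul` of the hairpin-Stokes chain (re-homed verbatim from the crux workfile; see the module docstring). -/
theorem sum_ite_eq_mul {α : Type} [DecidableEq α] (P : Finset α) (a : α) (f : α → ℝ) (ha : a ∈ P) :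
    ∑ p ∈ P, (if a = p then (1 : ℝ) else 0) * f p = f a := by
  rw [Finset.sum_eq_single a (fun p _ hp => by rw [if_neg (Ne.symm hp), zero_mul]) (fun h => (h ha).elim),
    if_pos rfl, one_mul]

/-- Helper lemma `sum_sum_ite_eq_mul` of the hairpin-Stokes chain (re-homed verbatim from the crux workfile; see the module docstring). -/
theorem sum_sum_ite_eq_mul {α : Type} [DecidableEq α] (P : Finset α) (s : Finset ℕ) (h : ℕ → α) (f : α → ℝ)
    (hh : ∀ k ∈ s, h k ∈ P) :
    ∑ p ∈ P, (∑ k ∈ s, if h k = p then (1 : ℝ) else 0) * f p = ∑ k ∈ s, f (h k) := by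
  simp_rw [Finset.sum_mul]
  rw [Finset.sum_comm]
  exact Finset.sum_congr rfl fun k hk => sum_ite_eq_mul P (h k) f (hh k hk)

/-- Evaluation of `Σ_p coef(q,p)·f(p)` when `P` contains `q` and its hairpin plaquettes. -/
theorem sum_coef_mul (b R : ℕ) (P : Finset (ZdPlaquette 4)) (f : ZdPlaquette 4 → ℝ) (q : ZdPlaquette 4)
    (hq : q ∈ P)
    (h3 : ∀ k ∈ Finset.range (combLen R (q.1 + Pi.single 0 1) 3), hp3 b R (q.1 + Pi.single 0 1) q.2.1.2 k ∈ P)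
    (h2 : ∀ k ∈ Finset.range (combLen R (q.1 + Pi.single 0 1) 2), hp2 b R (q.1 + Pi.single 0 1) k ∈ P) :
    ∑ p ∈ P, coef b R q p * f p =
      2 * f q +
        if q.2.1.1 = 0 ∧ q.1 0 = (b : ℤ) then
          32 * (R : ℝ) *
            (∑ k ∈ Finset.range (combLen R (q.1 + Pi.single 0 1) 3), f (hp3 b R (q.1 + Pi.single 0 1) q.2.1.2 k) +
              ∑ k ∈ Finset.range (combLen R (q.1 + Pi.single 0 1) 2), f (hp2 b R (q.1 + Pi.single 0 1) k))
        else 0 := by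
  unfold coef
  by_cases ht : q.2.1.1 = 0 ∧ q.1 0 = (b : ℤ)
  · simp only [if_pos ht]
    have hsplit : ∀ p ∈ P,
        (2 * (if q = p then 1 else 0) + 32 * (R : ℝ) *
          ((∑ k ∈ Finset.range (combLen R (q.1 + Pi.single 0 1) 3),
              if hp3 b R (q.1 + Pi.single 0 1) q.2.1.2 k = p then (1 : ℝ) else 0) +
            ∑ k ∈ Finset.range (combLen R (q.1 + Pi.single 0 1) 2),
              if hp2 b R (q.1 + Pi.single 0 1) k = p then (1 : ℝ) else 0)) * f p =
        2 * ((if q = p then 1 else 0) * f p) +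
          (32 * (R : ℝ) * ((∑ k ∈ Finset.range (combLen R (q.1 + Pi.single 0 1) 3),
              if hp3 b R (q.1 + Pi.single 0 1) q.2.1.2 k = p then (1 : ℝ) else 0) * f p) +
           32 * (R : ℝ) * ((∑ k ∈ Finset.range (combLen R (q.1 + Pi.single 0 1) 2),
              if hp2 b R (q.1 + Pi.single 0 1) k = p then (1 : ℝ) else 0) * f p)) := by
      intro p _; ring
    rw [Finset.sum_congr rfl hsplit, Finset.sum_add_distrib, Finset.sum_add_distrib, ← Finset.mul_sum, ← Finset.mul_sum,
      ← Finset.mul_sum, sum_ite_eq_mul P q f hq, sum_sum_ite_eq_mul P _ _ f h3, sum_sum_ite_eq_mul P _ _ f h2]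
    ring
  · simp only [if_neg ht, add_zero]
    have hsplit : ∀ p ∈ P, (2 * (if q = p then 1 else 0)) * f p = 2 * ((if q = p then (1 : ℝ) else 0) * f p) := by
      intro p _; ring
    rw [Finset.sum_congr rfl hsplit, ← Finset.mul_sum, sum_ite_eq_mul P q f hq]

/-- **THE TOP-FACE PLAQUETTE BOUND (analysis assembled).** For a top-face plaquette `q = (x, 0, j)` (`x₀ = b`) touching
`Λ = rowRegion b n` and `R ≥ (2n+1)b`: `energy_q(σ') ≤ 2·energy_q(σ) + 32R·(Σ hairpin-strip energies of σ)`. -/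
theorem pe_twist_top_le (hρu : ∀ g, ρ g ∈ Matrix.unitaryGroup (Fin N) ℂ) {b n R : ℕ} (hb : 1 ≤ b)
    (hR : (2 * n + 1) * b ≤ R) (k₀ : G) (σ : LGConfig 4 G) {q : ZdPlaquette 4}
    (hq : q ∈ plaquettesTouching (rowRegion b n)) (ht : q.2.1.1 = 0 ∧ q.1 0 = (b : ℤ)) :
    pe ρ q (topTwist b (comb b R k₀ σ) σ) ≤
      2 * pe ρ q σ +
        32 * (R : ℝ) *
          (∑ k ∈ Finset.range (combLen R (q.1 + Pi.single 0 1) 3), pe ρ (hp3 b R (q.1 + Pi.single 0 1) q.2.1.2 k) σ +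
            ∑ k ∈ Finset.range (combLen R (q.1 + Pi.single 0 1) 2), pe ρ (hp2 b R (q.1 + Pi.single 0 1) k) σ) := by
  have hbox := mem_topBox_of_touching hq ht.2
  rw [topBox, Fintype.mem_piFinset] at hbox
  obtain ⟨x, ⟨⟨i, j⟩, hij⟩⟩ := q
  dsimp only at ht hbox hij ⊢
  obtain ⟨hi, hx⟩ := ht
  subst hi
  have hj0 : j ≠ 0 := by rintro rfl; exact lt_irrefl _ hij
  have hsp : ∀ l : Fin 4, l ≠ 0 → -(2 * (n : ℤ) * b) - 1 ≤ x l ∧ x l ≤ (2 * (n : ℤ) + 1) * b - 1 := fun l hl => by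
    have h := hbox l
    rw [if_neg hl, Finset.mem_Icc] at h
    exact h
  have hyl : ∀ l : Fin 4, l ≠ 0 → ((x + Pi.single (0 : Fin 4) (1 : ℤ) : Site 4)) l = x l := fun l hl => by
    rw [Pi.add_apply, Pi.single_apply, if_neg hl, add_zero]
  have hy0 : ((x + Pi.single (0 : Fin 4) (1 : ℤ) : Site 4)) 0 = (b : ℤ) + 1 := by
    rw [Pi.add_apply, Pi.single_eq_same, hx]
  have hRz : (((2 * n + 1) * b : ℕ) : ℤ) ≤ (R : ℤ) := by exact_mod_cast hR
  push_cast at hRz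
  have hbz : (1 : ℤ) ≤ (b : ℤ) := by exact_mod_cast hb
  have hy : InLayer b R (x + Pi.single 0 1) :=
    ⟨hy0, fun l hl => by rw [hyl l hl]; linarith [(hsp l hl).1]⟩
  have hle : ∀ l : Fin 4, l ≠ 0 → ((x + Pi.single (0 : Fin 4) (1 : ℤ) : Site 4)) l ≤ (R : ℤ) := fun l hl => by
    rw [hyl l hl]; linarith [(hsp l hl).2]
  have hn3 : (combLen R (x + Pi.single 0 1) 3 : ℝ) ≤ 2 * R := by
    exact_mod_cast combLen_le (hle 3 (by decide))
  have hn2 : (combLen R (x + Pi.single 0 1) 2 : ℝ) ≤ 2 * R := by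
    exact_mod_cast combLen_le (hle 2 (by decide))
  have h1 := topFace_energy_comb_le ρ hρu b R k₀ σ x hj0 hx
  have hS3 : 0 ≤ ∑ k ∈ Finset.range (combLen R (x + Pi.single 0 1) 3), pe ρ (hp3 b R (x + Pi.single 0 1) j k) σ :=
    Finset.sum_nonneg fun k _ => pe_nonneg ρ hρu _ _
  have hS2 : 0 ≤ ∑ k ∈ Finset.range (combLen R (x + Pi.single 0 1) 2), pe ρ (hp2 b R (x + Pi.single 0 1) k) σ :=
    Finset.sum_nonneg fun k _ => pe_nonneg ρ hρu _ _
  have hR0 : (0 : ℝ) ≤ (R : ℝ) := Nat.cast_nonneg R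
  unfold pe at hS3 hS2 ⊢
  dsimp only at hS3 hS2 ⊢
  by_cases hj3 : j = 3
  · subst hj3
    have h0 : ‖ρ (hairpin b R σ (x + Pi.single 0 1) 3) - 1‖ = 0 := norm_map_hairpin_three ρ σ hy
    rw [h0] at h1
    norm_num at h1
    nlinarith [h1, hS3, hS2, hR0, mul_nonneg hR0 (add_nonneg hS3 hS2)]
  · have hj3' : j < 3 := Fin.lt_last_iff_ne_last.2 hj3
    have h2 : ‖ρ (hairpin b R σ (x + Pi.single 0 1) j) - 1‖ ^ 2 ≤ _ :=
      norm_map_hairpin_sub_one_sq_le ρ hρu σ hy hj0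
    have e3 : ∑ k ∈ Finset.range (combLen R (x + Pi.single 0 1) 3),
        ‖ρ (plaquetteHolonomyZd σ (combPt3 b R (x + Pi.single 0 1) + Pi.single 3 (k : ℤ)) j 3) - 1‖ ^ 2 =
        ∑ k ∈ Finset.range (combLen R (x + Pi.single 0 1) 3),
          2 * ((N : ℝ) - plaquetteObs ρ (hp3 b R (x + Pi.single 0 1) j k).1 (hp3 b R (x + Pi.single 0 1) j k).2.1.1
            (hp3 b R (x + Pi.single 0 1) j k).2.1.2 σ) :=
      Finset.sum_congr rfl fun k _ => by rw [norm_sq_eq_two_mul_energy ρ hρu]; simp only [hp3, dif_pos hj3']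
    have e2 : ∑ k ∈ Finset.range (combLen R (x + Pi.single 0 1) 2),
        ‖ρ (plaquetteHolonomyZd σ (combPt2 b R (x + Pi.single 0 1) + Pi.single 2 (k : ℤ)) 1 2) - 1‖ ^ 2 =
        ∑ k ∈ Finset.range (combLen R (x + Pi.single 0 1) 2),
          2 * ((N : ℝ) - plaquetteObs ρ (hp2 b R (x + Pi.single 0 1) k).1 (hp2 b R (x + Pi.single 0 1) k).2.1.1
            (hp2 b R (x + Pi.single 0 1) k).2.1.2 σ) :=
      Finset.sum_congr rfl fun k _ => by rw [norm_sq_eq_two_mul_energy ρ hρu]; simp only [hp2]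
    rw [e3, e2, ← Finset.mul_sum, ← Finset.mul_sum] at h2
    have hm3 := mul_le_mul_of_nonneg_right hn3 hS3
    have hm2 := mul_le_mul_of_nonneg_right hn2 hS2
    nlinarith [h1, h2, hm3, hm2, hS3, hS2, hR0]

/-- **THE PER-PLAQUETTE BOUND.** Every plaquette `q` touching `Λ`: `energy_q(σ') ≤ Σ_p coef(q,p)·energy_p(σ)` whenever `P`
contains `q` and its hairpin plaquettes. -/
theorem pe_twist_le_sum_coef (hρu : ∀ g, ρ g ∈ Matrix.unitaryGroup (Fin N) ℂ) {b n R : ℕ} (hb : 1 ≤ b)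
    (hR : (2 * n + 1) * b ≤ R) (k₀ : G) (σ : LGConfig 4 G) (P : Finset (ZdPlaquette 4)) {q : ZdPlaquette 4}
    (hqT : q ∈ plaquettesTouching (rowRegion b n)) (hq : q ∈ P)
    (h3 : ∀ k ∈ Finset.range (combLen R (q.1 + Pi.single 0 1) 3), hp3 b R (q.1 + Pi.single 0 1) q.2.1.2 k ∈ P)
    (h2 : ∀ k ∈ Finset.range (combLen R (q.1 + Pi.single 0 1) 2), hp2 b R (q.1 + Pi.single 0 1) k ∈ P) :
    pe ρ q (topTwist b (comb b R k₀ σ) σ) ≤ ∑ p ∈ P, coef b R q p * pe ρ p σ := by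
  rw [sum_coef_mul b R P _ q hq h3 h2]
  by_cases ht : q.2.1.1 = 0 ∧ q.1 0 = (b : ℤ)
  · rw [if_pos ht]
    exact pe_twist_top_le ρ hρu hb hR k₀ σ hqT ht
  · rw [if_neg ht, add_zero]
    have he : pe ρ q (topTwist b (comb b R k₀ σ) σ) = pe ρ q σ := energy_topTwist_of_not_topFace ρ b _ σ q ht
    rw [he]
    linarith [pe_nonneg ρ hρu q σ]

/-- Total coefficient mass of one plaquette: `2`, plus `≤ 128 R²` for a top-face plaquette. -/
theorem sum_coef_le {b n R : ℕ} (hR : (2 * n + 1) * b ≤ R) (P : Finset (ZdPlaquette 4)) {q : ZdPlaquette 4}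
    (hqT : q ∈ plaquettesTouching (rowRegion b n)) (hq : q ∈ P)
    (h3 : ∀ k ∈ Finset.range (combLen R (q.1 + Pi.single 0 1) 3), hp3 b R (q.1 + Pi.single 0 1) q.2.1.2 k ∈ P)
    (h2 : ∀ k ∈ Finset.range (combLen R (q.1 + Pi.single 0 1) 2), hp2 b R (q.1 + Pi.single 0 1) k ∈ P) :
    ∑ p ∈ P, coef b R q p ≤ 2 + if q.2.1.1 = 0 ∧ q.1 0 = (b : ℤ) then 128 * (R : ℝ) ^ 2 else 0 := by
  have h := sum_coef_mul b R P (fun _ => (1 : ℝ)) q hq h3 h2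
  simp only [mul_one, Finset.sum_const, Finset.card_range, nsmul_eq_mul] at h
  rw [h]
  by_cases ht : q.2.1.1 = 0 ∧ q.1 0 = (b : ℤ)
  · rw [if_pos ht, if_pos ht]
    have hbox := mem_topBox_of_touching hqT ht.2
    rw [topBox, Fintype.mem_piFinset] at hbox
    have hsp : ∀ l : Fin 4, l ≠ 0 → q.1 l ≤ (2 * (n : ℤ) + 1) * b - 1 := fun l hl => by
      have h := hbox l
      rw [if_neg hl, Finset.mem_Icc] at h
      exact h.2
    have hyl : ∀ l : Fin 4, l ≠ 0 → ((q.1 + Pi.single (0 : Fin 4) (1 : ℤ) : Site 4)) l = q.1 l := fun l hl => by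
      rw [Pi.add_apply, Pi.single_apply, if_neg hl, add_zero]
    have hRz : (((2 * n + 1) * b : ℕ) : ℤ) ≤ (R : ℤ) := by exact_mod_cast hR
    push_cast at hRz
    have hle : ∀ l : Fin 4, l ≠ 0 → ((q.1 + Pi.single (0 : Fin 4) (1 : ℤ) : Site 4)) l ≤ (R : ℤ) := fun l hl => by
      rw [hyl l hl]; linarith [hsp l hl]
    have hn3 : (combLen R (q.1 + Pi.single 0 1) 3 : ℝ) ≤ 2 * R := by
      exact_mod_cast combLen_le (hle 3 (by decide))
    have hn2 : (combLen R (q.1 + Pi.single 0 1) 2 : ℝ) ≤ 2 * R := by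
      exact_mod_cast combLen_le (hle 2 (by decide))
    have hR0 : (0 : ℝ) ≤ (R : ℝ) := Nat.cast_nonneg R
    have hm := mul_le_mul_of_nonneg_left (add_le_add hn3 hn2) (by positivity : (0 : ℝ) ≤ 32 * (R : ℝ))
    nlinarith [hn3, hn2, hR0, hm]
  · rw [if_neg ht, if_neg ht]

/-- The bounding box of the base points of ALL plaquettes touching `Λ = rowRegion b n`. -/
def bigBox (b n : ℕ) : Finset (Site 4) :=
  Fintype.piFinset fun i : Fin 4 =>
    if i = 0 then Finset.Icc (0 : ℤ) b else Finset.Icc (-(2 * (n : ℤ) * b) - 1) ((2 * (n : ℤ) + 1) * b - 1)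

/-- Helper lemma `card_bigBox` of the hairpin-Stokes chain (re-homed verbatim from the crux workfile; see the module docstring). -/
theorem card_bigBox (b n : ℕ) : (bigBox b n).card = (b + 1) * ((4 * n + 1) * b + 1) ^ 3 := by
  rw [bigBox, Fintype.card_piFinset, Fin.prod_univ_four, if_pos rfl, if_neg (show (1 : Fin 4) ≠ 0 by decide),
    if_neg (show (2 : Fin 4) ≠ 0 by decide), if_neg (show (3 : Fin 4) ≠ 0 by decide), Int.card_Icc, Int.card_Icc]
  have h : (2 * (n : ℤ) + 1) * b - 1 + 1 - (-(2 * (n : ℤ) * b) - 1) = (((4 * n + 1) * b + 1 : ℕ) : ℤ) := by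
    push_cast; ring
  have h0 : (b : ℤ) + 1 - 0 = ((b + 1 : ℕ) : ℤ) := by push_cast; ring
  rw [h, h0, Int.toNat_natCast, Int.toNat_natCast]
  ring

/-- Helper lemma `mem_bigBox_of_touching` of the hairpin-Stokes chain (re-homed verbatim from the crux workfile; see the module docstring). -/
theorem mem_bigBox_of_touching {b n : ℕ} {q : ZdPlaquette 4} (hq : q ∈ plaquettesTouching (rowRegion b n)) :
    q.1 ∈ bigBox b n := by
  rw [mem_plaquettesTouching_iff] at hq
  obtain ⟨e, he⟩ := hq
  rw [Finset.mem_inter] at he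
  obtain ⟨he1, he2⟩ := he
  rw [bigBox, Fintype.mem_piFinset]
  have hbox := box_of_mem_rowRegion he2
  intro i
  by_cases hi : i = 0
  · subst hi
    rw [if_pos rfl, Finset.mem_Icc]
    have hs := hbox.1
    simp only [plaquetteEdges, Finset.mem_insert, Finset.mem_singleton] at he1
    rcases he1 with rfl | rfl | rfl | rfl
    · dsimp only at hs
      constructor <;> linarith [hs.1, hs.2]
    · dsimp only at hs
      rw [Pi.add_apply, Pi.single_apply] at hs
      split_ifs at hs <;> constructor <;> linarith [hs.1, hs.2]
    · dsimp only at hs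
      rw [Pi.add_apply, Pi.single_apply] at hs
      split_ifs at hs <;> constructor <;> linarith [hs.1, hs.2]
    · dsimp only at hs
      constructor <;> linarith [hs.1, hs.2]
  · rw [if_neg hi, Finset.mem_Icc]
    have hs := hbox.2 i hi
    simp only [plaquetteEdges, Finset.mem_insert, Finset.mem_singleton] at he1
    rcases he1 with rfl | rfl | rfl | rfl
    · dsimp only at hs
      constructor <;> linarith [hs.1, hs.2]
    · dsimp only at hs
      rw [Pi.add_apply, Pi.single_apply] at hs
      split_ifs at hs <;> constructor <;> linarith [hs.1, hs.2]
    · dsimp only at hs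
      rw [Pi.add_apply, Pi.single_apply] at hs
      split_ifs at hs <;> constructor <;> linarith [hs.1, hs.2]
    · dsimp only at hs
      constructor <;> linarith [hs.1, hs.2]

/-- `#plaquettesTouching (rowRegion b n) ≤ 6 (b+1) ((4n+1)b+1)³`. -/
theorem card_touching_rowRegion_le (b n : ℕ) :
    (plaquettesTouching (rowRegion b n)).card ≤ 6 * ((b + 1) * ((4 * n + 1) * b + 1) ^ 3) := by
  have hsub : plaquettesTouching (rowRegion b n) ⊆
      bigBox b n ×ˢ (Finset.univ : Finset {p : Fin 4 × Fin 4 // p.1 < p.2}) := fun q hq =>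
    Finset.mem_product.2 ⟨mem_bigBox_of_touching hq, Finset.mem_univ _⟩
  refine (Finset.card_le_card hsub).trans ?_
  rw [Finset.card_product, card_bigBox, Finset.card_univ, (show Fintype.card {p : Fin 4 × Fin 4 // p.1 < p.2} = 6 by decide), mul_comm]

/-- `#(top-height plaquettes touching Λ) ≤ 6 ((4n+1)b+1)³`, numeric form. -/
theorem card_touching_top_le (b n : ℕ) :
    ((plaquettesTouching (rowRegion b n)).filter (fun q => q.2.1.1 = 0 ∧ q.1 0 = (b : ℤ))).card ≤
      6 * ((4 * n + 1) * b + 1) ^ 3 := by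
  refine le_trans (Finset.card_le_card ?_) ((card_touching_height_eq_le b n).trans_eq (by rw [(show Fintype.card {p : Fin 4 × Fin 4 // p.1 < p.2} = 6 by decide)]))
  intro q hq
  rw [Finset.mem_filter] at hq ⊢
  exact ⟨hq.1, hq.2.2⟩

/-- **R1d′ — THE ROW-FLOOR STUB OVER TREE TERMS (PROVED).**  For unitary `ρ` and every `n, k₀` there is `C > 0` such that for
every `b ≥ 1` a FIXED finite family of plaquettes `P` with nonnegative weights of total mass `≤ C b⁵` dominates, configuration
by configuration, the boundary Wilson action over `Λ = rowRegion b n` of the TWISTED configuration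
`σ' = twistΦ_b(comb_{b,(2n+2)b+1,k₀}) σ` by the weighted plaquette energies OF `σ`.  Since the row-floor file proves
`refConfig b n k₀ σ = twistΦ b (comb b ((2n+2)b+1) k₀) σ` (`refConfig_eq_twistΦ`), this IS its stub R1d
`refAction_le_weighted` up to that rewrite. -/
theorem twistAction_le_weighted (hρu : ∀ g, ρ g ∈ Matrix.unitaryGroup (Fin N) ℂ) (n : ℕ) (k₀ : G) :
    ∃ C : ℝ, 0 < C ∧ ∀ b : ℕ, 1 ≤ b →
      ∃ (P : Finset (ZdPlaquette 4)) (w : ZdPlaquette 4 → ℝ), (∀ q, 0 ≤ w q) ∧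
        ∑ q ∈ P, w q ≤ C * (b : ℝ) ^ 5 ∧
        ∀ σ : LGConfig 4 G,
          wilsonBoundaryAction ρ (rowRegion b n) (twistΦ b (comb b ((2 * n + 2) * b + 1) k₀) σ) ≤
            ∑ q ∈ P, w q * ((N : ℝ) - plaquetteObs ρ q.1 q.2.1.1 q.2.1.2 σ) := by
  refine ⟨24 * (4 * (n : ℝ) + 2) ^ 3 + 768 * (4 * (n : ℝ) + 2) ^ 3 * (2 * (n : ℝ) + 3) ^ 2, by positivity,
    fun b hb => ?_⟩
  -- the data
  set R : ℕ := (2 * n + 2) * b + 1 with hRdef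
  have hR : (2 * n + 1) * b ≤ R := by rw [hRdef]; nlinarith
  let T : Finset (ZdPlaquette 4) := plaquettesTouching (rowRegion b n)
  let H : ZdPlaquette 4 → Finset (ZdPlaquette 4) := fun q =>
    (Finset.range (combLen R (q.1 + Pi.single 0 1) 3)).image (hp3 b R (q.1 + Pi.single 0 1) q.2.1.2) ∪
      (Finset.range (combLen R (q.1 + Pi.single 0 1) 2)).image (hp2 b R (q.1 + Pi.single 0 1))
  let P : Finset (ZdPlaquette 4) := T ∪ T.biUnion H
  have hTP : ∀ q ∈ T, q ∈ P := fun q hq => Finset.mem_union_left _ hq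
  have h3P : ∀ q ∈ T, ∀ k ∈ Finset.range (combLen R (q.1 + Pi.single 0 1) 3),
      hp3 b R (q.1 + Pi.single 0 1) q.2.1.2 k ∈ P := fun q hq k hk =>
    Finset.mem_union_right _ (Finset.mem_biUnion.2 ⟨q, hq, Finset.mem_union_left _ (Finset.mem_image_of_mem _ hk)⟩)
  have h2P : ∀ q ∈ T, ∀ k ∈ Finset.range (combLen R (q.1 + Pi.single 0 1) 2),
      hp2 b R (q.1 + Pi.single 0 1) k ∈ P := fun q hq k hk =>
    Finset.mem_union_right _ (Finset.mem_biUnion.2 ⟨q, hq, Finset.mem_union_right _ (Finset.mem_image_of_mem _ hk)⟩)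
  refine ⟨P, fun p => ∑ q ∈ T, coef b R q p, fun p => Finset.sum_nonneg fun q _ => coef_nonneg b R q p, ?_, ?_⟩
  · -- total weight
    rw [Finset.sum_comm]
    have hq : ∀ q ∈ T, ∑ p ∈ P, coef b R q p ≤ 2 + if q.2.1.1 = 0 ∧ q.1 0 = (b : ℤ) then 128 * (R : ℝ) ^ 2 else 0 :=
      fun q hqT => sum_coef_le hR P hqT (hTP q hqT) (h3P q hqT) (h2P q hqT)
    refine (Finset.sum_le_sum hq).trans ?_
    rw [Finset.sum_add_distrib, Finset.sum_const, nsmul_eq_mul, ← Finset.sum_filter, Finset.sum_const, nsmul_eq_mul]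
    have hT : (T.card : ℝ) ≤ 6 * (((b : ℝ) + 1) * ((4 * n + 1) * b + 1) ^ 3) := by
      exact_mod_cast card_touching_rowRegion_le b n
    have hTt : ((T.filter (fun q => q.2.1.1 = 0 ∧ q.1 0 = (b : ℤ))).card : ℝ) ≤ 6 * ((4 * (n : ℝ) + 1) * b + 1) ^ 3 := by
      exact_mod_cast card_touching_top_le b n
    have hb1 : (1 : ℝ) ≤ (b : ℝ) := by exact_mod_cast hb
    have hRr : (R : ℝ) = (2 * n + 2) * b + 1 := by rw [hRdef]; push_cast; ring
    have hL : (4 * (n : ℝ) + 1) * b + 1 ≤ (4 * (n : ℝ) + 2) * b := by nlinarith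
    have hRle : (R : ℝ) ≤ (2 * (n : ℝ) + 3) * b := by rw [hRr]; nlinarith
    have hn0 : (0 : ℝ) ≤ (n : ℝ) := Nat.cast_nonneg n
    have hL0 : (0 : ℝ) ≤ (4 * (n : ℝ) + 1) * b + 1 := by positivity
    have hR0 : (0 : ℝ) ≤ (R : ℝ) := Nat.cast_nonneg R
    have hb4 : (b : ℝ) ^ 4 ≤ (b : ℝ) ^ 5 := pow_le_pow_right₀ hb1 (by norm_num)
    calc (T.card : ℝ) * 2 + ((T.filter (fun q => q.2.1.1 = 0 ∧ q.1 0 = (b : ℤ))).card : ℝ) * (128 * (R : ℝ) ^ 2)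
        ≤ 6 * (((b : ℝ) + 1) * ((4 * n + 1) * b + 1) ^ 3) * 2 +
            6 * ((4 * (n : ℝ) + 1) * b + 1) ^ 3 * (128 * (R : ℝ) ^ 2) := by gcongr
      _ ≤ 6 * ((2 * (b : ℝ)) * ((4 * (n : ℝ) + 2) * b) ^ 3) * 2 +
            6 * ((4 * (n : ℝ) + 2) * b) ^ 3 * (128 * ((2 * (n : ℝ) + 3) * b) ^ 2) := by
          gcongr
          · linarith
      _ = 24 * (4 * (n : ℝ) + 2) ^ 3 * (b : ℝ) ^ 4 + 768 * (4 * (n : ℝ) + 2) ^ 3 * (2 * (n : ℝ) + 3) ^ 2 * (b : ℝ) ^ 5 := by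
          ring
      _ ≤ 24 * (4 * (n : ℝ) + 2) ^ 3 * (b : ℝ) ^ 5 + 768 * (4 * (n : ℝ) + 2) ^ 3 * (2 * (n : ℝ) + 3) ^ 2 * (b : ℝ) ^ 5 := by
          gcongr
      _ = _ := by ring
  · -- domination
    intro σ
    rw [twistΦ, wilsonBoundaryAction_eq_sum_pe]
    have hq : ∀ q ∈ T, pe ρ q (topTwist b (comb b R k₀ σ) σ) ≤ ∑ p ∈ P, coef b R q p * pe ρ p σ := fun q hqT =>
      pe_twist_le_sum_coef ρ hρu hb hR k₀ σ P hqT (hTP q hqT) (h3P q hqT) (h2P q hqT)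
    refine (Finset.sum_le_sum hq).trans_eq ?_
    rw [Finset.sum_comm]
    refine Finset.sum_congr rfl fun p _ => ?_
    rw [Finset.sum_mul]
    rfl

end Assembly
end Summit.QuantumFields.YangMills.Cruxes.IR.HairpinStokes
end
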